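import Literature.Computability.AlgebraicComplexity.FSV18SuccinctGenerators
import HarnessLib

/-!
# [ASSS16] §4, the depth-`D` occur-`k` theorem AS PRINTED (top fan-in `≤ t` after the reduction):
# the class, the recursion bound and the named statement `FSV2018_thm48_topFanIn`
# (val-lit p1 g3; N1 occur push, plan step F1; lead-np RULINGS (31)(c), (33)(e))

Source: Agrawal–Saha–Saptharishi–Saxena, *Jacobian hits circuits*, arXiv:1111.0582, §4 (held
`paper:arxiv-1111.0582` p0009–p0010): after the opening reduction "By reusing symbols, assume that
`C` is a depth-`D` occur-`k` formula of size `s` with a `+` gate on top having top fanin at most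
`k`" (p0009:L22–L24) the theorem `thm:dDkrPIT` is proved by the recursion of Lemma 4.2 /
Cor. 4.3: "`r_{ℓ+1} := (c_ℓ + 1)·2^{c_ℓ+1}·k·r_ℓ²` … `c_{ℓ+1} := c_ℓ + 1`" (p0010:L28–L33), "To begin
with: `ℓ = 2` … `r_2 ≤ k` and `c_2 = 0`" (p0010:L18–L20), "we eventually reach the level of the sparse
polynomials at depth `D − 2` … it is easy to bound `r_{D−2}` by `R = (2k)^{2D·2^D}`" (p0010:L40–L43),
"For the Jacobian criterion to work we need `char(𝔽) = 0` or `> s^R`" (p0010:L60–L62). Bib key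
`AgrawalEtAl2011`. FSV 2018 Thm. 48 (`FSV2018_thm48`, `FSV18SuccinctGenerators.lean`) quotes this
theorem for the WHOLE class `occurClass D k s` (no top-fan-in bound, abstract sparse-hitting block
`Φ`), which the printed proof reaches only at the hitting-SET level (the shifts `α + e_i`,
p0009:L3–L20) — provenance B14, val-lit memo HOME/np/p1g3-THM48-provenance-and-plan.md; the tree's
route to FSV Cor. 49 / the occur conjunct of `FSV2018_thm9` (safe reading, RULING (33)) is THIS
statement + the generator-form shift `ASSS16.isHittingSetGenerator_succ_of_unitDifferences`
(`FSV18OccurShiftReduction.lean`).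

What is here (definitions + ONE named fact; statement-only file):
* `OccurArgs.length` — the fan-in of a `+` gate's argument list (FSV Def. 45 model).
* `occurClassTopFanIn F ι D k s t` — members of `occurClass D k s` computed by a formula whose ROOT
  is a `+` gate of fan-in `≤ t` ([ASSS16]'s reduced class; ASSS take `t = k`).
* `asssRec k t j = (r_{2+j}, c_{2+j})` — the printed recursion (documentation of the bound) — and
  `asssRTop k D t = (2·max(k,t))^{2D·2^D} = asssR (max k t) D`, the PRINTED closed form `R` (print:
  `t = k`), which is what enters the statement (seeds, sparsity budget, characteristic clause;
  CORRECTION 2026-08-26: the first text used the bare recursion value `r_{D−2}` there, claiming more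
  than print in positive characteristic — see `asssRTop`).
* NAMED FACT `FSV2018_thm48_topFanIn` — [ASSS16] `thm:dDkrPIT` as printed, in FSV's generator
  vocabulary (the seed layout of `FSV2018_thm48` with `R := asssRTop k D t`): for a sparse-hitting
  `Φ` (sparsity `≤ R!·s^R`) some choice `r_ℓ ≤ R` of Vandermonde block sizes makes
  `Σ_ℓ Vandermonde_{r_ℓ} ⊕ Φ` a hitting-set generator for `occurClassTopFanIn … D k s t`, in
  characteristic `0` or `> s^R`.
* `occurClassTopFanIn_subset_occurClass` (proved).

Honest framing: a statement file (one R1 fact = a published theorem with its printed proof, to be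
discharged by plan steps F2–F4); `VP ≠ VNP` is NOT proved and nothing here bears on it.
-/

noncomputable section

namespace Literature.Computability.AlgebraicComplexity

open MvPolynomial Finset Literature.Barriers.ValiantsHypothesis

universe u v

section Model

variable {F : Type u} [CommSemiring F] {ι : Type v}

/-- The **fan-in** of a `+` gate's argument list (number of children; FSV Def. 45's occur-`k`
formula model, `OccurArgs`). [cite: ForbesShpilkaVolk2018, Def. 45 (seq.) = ToC Def. 5.21, p. 29] -/
def OccurArgs.length : OccurArgs F ι → ℕ
  | .nil => 0
  | .cons _ as => OccurArgs.length as + 1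

end Model

section Classes

variable (F : Type*) [CommRing F]

/-- **[ASSS16]'s reduced class** ("a depth-`D` occur-`k` formula of size `s` with a `+` gate on top
having top fanin at most `k`", arXiv:1111.0582 p0009:L22–L24; here the fan-in bound is its own
parameter `t`): the polynomials computed by occur formulas (FSV Def. 45 model, bounds read "at
most" as in `occurClass`) whose root is a `+` gate with at most `t` children.
[cite: AgrawalEtAl2011, §4 (¶1, the class `𝒞̃`)] locator: paper:arxiv-1111.0582 p0009.txt:L10–L24 -/
def occurClassTopFanIn (ι : Type*) (D k s t : ℕ) : Set (MvPolynomial ι F) :=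
  {f | ∃ as : OccurArgs F ι, (OccurFormula.add as).eval = f ∧ (OccurFormula.add as).depth ≤ D ∧
    (∀ i, (OccurFormula.add as).occur i ≤ k) ∧ (OccurFormula.add as).size ≤ s ∧ as.length ≤ t}

variable {F}

/-- The reduced class is a subclass of FSV's `occurClass`. [cite: AgrawalEtAl2011, §4 (¶1)] -/
theorem occurClassTopFanIn_subset_occurClass (ι : Type*) (D k s t : ℕ) :
    occurClassTopFanIn F ι D k s t ⊆ occurClass F ι D k s := by
  rintro f ⟨as, hf, hD, hk, hs, -⟩
  exact ⟨OccurFormula.add as, hf, hD, hk, hs⟩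

end Classes

/-- **The recursion of [ASSS16] Lemma 4.2 / Cor. 4.3** (arXiv:1111.0582 p0010:L18–L33): starting
from `(r_2, c_2) = (t, 0)` (`t` = top fan-in; print: `r_2 ≤ k`, `c_2 = 0`), one step is
`(r, c) ↦ ((c+1)·2^{c+1}·k·r², c+1)`; `asssRec k t j = (r_{2+j}, c_{2+j})`.
[cite: AgrawalEtAl2011, Lemma 4.2 and Cor. 4.3] locator: paper:arxiv-1111.0582 p0010.txt:L18–L33 -/
def asssRec (k t : ℕ) : ℕ → ℕ × ℕ
  | 0 => (t, 0)
  | j + 1 => (((asssRec k t j).2 + 1) * 2 ^ ((asssRec k t j).2 + 1) * k * (asssRec k t j).1 ^ 2,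
      (asssRec k t j).2 + 1)

/-- **`R = (2·max(k,t))^{2D·2^D}`, the PRINTED closed form** ("it is easy to bound `r_{D−2}` by
`R = (2k)^{2D·2^D}`", p0010:L40–L43, stated in print for top fan-in `t = k`; here `max k t` so that
the recursion started at `r_2 = t` is covered for every `t`): the number of seeds per Vandermonde
block, the sparsity budget `R!·s^R` of the bottom map and — decisively — the characteristic clause
`char > s^R` (p0010:L60–L62) of `FSV2018_thm48_topFanIn`. CORRECTION 2026-08-26 (typer, same day,
before any referee stamp): the first landed text took `R := r_{D−2}` = `(asssRec k t (D − 4)).1`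
exactly; in the clause `char > s^R` that is WEAKER than print (the Jacobian criterion is invoked at
every level `ℓ` on `≤ r_ℓ` polynomials of degree up to `s^D`, p0009:L29 "char = 0 or `> s^{Dr}`",
which the closed form dominates and the bare `r_{D−2}` does not), i.e. it claimed more than
[ASSS16] prove; the recursion `asssRec` stays as the documented source of the bound. For `t = k`
this is `asssR k D` verbatim. [cite: AgrawalEtAl2011, §4 (Thm. dDkrPIT, proof)]
locator: paper:arxiv-1111.0582 p0010.txt:L40–L43, L60–L62 -/
def asssRTop (k D t : ℕ) : ℕ := asssR (max k t) D

/-- NAMED FACT (**[ASSS16] §4, Theorem `thm:dDkrPIT`, AS PRINTED — after the top-fan-in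
reduction**; FSV Thm. 48 = this statement quoted for the whole class, see `FSV2018_thm48` and its
B14 caveat). For depth-`D` occur-`k` size-`s` formulas whose root `+` gate has fan-in `≤ t`, with
`R := asssRTop k D t`: if `Φ` hits every polynomial of sparsity `≤ R!·s^R` ("using [KS01], the
nonzeroness of this determinant [sparsity `s^R`, here FSV's `R!·s^R`] is maintained by one of the
maps `Φ_p`", p0010:L50–L55) then for some block sizes `r_ℓ ≤ R` the map
`X_i ↦ Σ_ℓ Σ_{j ≤ r_ℓ} y_{j,ℓ} t_ℓ^{ij} + Φ(w)_i` ("lift this map `Ψ_{D-2}` to `Ψ_2` that is faithful to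
`T` using Corollary 4.3", p0010:L56–L58; faithful ⇒ generator by Thm. 2.1) is a hitting-set generator
for `occurClassTopFanIn … D k s t`, assuming `char(𝔽) = 0` or `char(𝔽) > s^R` (p0010:L60–L62).
Seed layout verbatim that of `FSV2018_thm48` (`D − 2` block slots of `R` seeds each, unused seeds
allowed, `r_ℓ = 0` allowed). Plan: discharged by F2 (Lemmas 4.1/4.2 on `OccurFormula`), F3
(Cor. 4.3 from `ForbesShpilkaVolk2018_lemma52_allFields`), F4 (the recursion); consumed by
`ASSS16.isHittingSetGenerator_succ_of_unitDifferences` towards `FSV2018_thm9_occur` (safe reading,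
lead-np RULING (33)). [cite: AgrawalEtAl2011, §4 (Thm. dDkrPIT)]
locator: paper:arxiv-1111.0582 p0008.txt:L21, p0009.txt:L22–L34, p0010.txt:L40–L62 -/
def FSV2018_thm48_topFanIn : Prop :=
  ∀ (F : Type) [Field F] (n D k s t : ℕ) (τ : Type)
    (Φ : multilinearMonomials n → MvPolynomial τ F),
    (ringChar F = 0 ∨ s ^ asssRTop k D t < ringChar F) →
    IsHittingSetGenerator
      {P : MvPolynomial (multilinearMonomials n) F |
        P.support.card ≤ (asssRTop k D t).factorial * s ^ asssRTop k D t} Φ →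
    ∃ r : Fin (D - 2) → Fin (asssRTop k D t + 1),
      IsHittingSetGenerator (occurClassTopFanIn F (multilinearMonomials n) D k s t)
        (fun m : multilinearMonomials n =>
          (∑ ℓ : Fin (D - 2),
            rename (fun v : Fin (r ℓ) ⊕ Unit =>
                (Sum.inl (ℓ, Sum.map (Fin.castLE (Nat.lt_succ_iff.mp (r ℓ).isLt)) id v) :
                  (Fin (D - 2) × (Fin (asssRTop k D t) ⊕ Unit)) ⊕ τ))
              (vdmGenCoeff F n (r ℓ) (m : Fin n →₀ ℕ))) +
            rename Sum.inr (Φ m))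

end Literature.Computability.AlgebraicComplexity

end
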